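import Summits.Ventures.CertifiedArithmetic.LowPrec.SRBiasSign
import HarnessLib

/-!
# Double stochastic rounding is innocuous iff the target embeds (file XL)

HONEST FRAMING: certified error envelopes and provably optimal rounding/accumulation schemes for
low-precision formats under stated cost models; every table by two implementations; no hardware or
vendor claims.

COMPOSITION OF TWO STOCHASTIC ROUNDINGS.  A value `c` is first rounded stochastically
(saturating SR, `step` of file I) into an INTERMEDIATE finite set `G` and the result is rounded
stochastically into the TARGET `F` — the situation of a wide SR accumulator whose contents are
later requantised by SR, or of an SR conversion pipeline `binary32 → FP8 → FP4`.  Is the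
composite THE SAME ROUNDING as one SR step into `F`?  This file answers over an arbitrary
linearly ordered field and arbitrary finite sets; file XLI (`SRDoubleRoundingFormats`)
specialises to minifloat formats, where the answer is the conversion lattice.

* `step_eq_affine` — the structural fact behind everything: for `c` in the hull of `F` with
  candidates `d ≤ u`, the one-step expectation `y ↦ E f(SR_F(y))` is AFFINE on the whole cell
  `[d, u]` (for every test function `f`): the chord of `f` between `f(d)` and `f(u)`.
* **`step_step_of_subset` (innocuous direction): if `F ⊆ G` then for EVERY input `c` and EVERY
  `f`, `E f(SR_F(SR_G(c))) = E f(SR_F(c))`** — the composite has exactly the law of a single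
  stochastic rounding into `F`, saturation of either step included, no gap condition.  (Both
  `G`-candidates of `c` lie in the `F`-cell of `c`, on which the inner expectation is a chord,
  and SR reproduces affine functions.)
* **`subset_of_step_step` (converse): if `F` has at least two elements and the composite agrees
  with single SR merely on the quadratic tests `f = (· − x)²` at the points `x ∈ F`, then
  `F ⊆ G`.**  Hence `step_step_iff_subset`: DOUBLE SR IS INNOCUOUS IFF THE TARGET EMBEDS IN
  THE INTERMEDIATE SET (a singleton target is the only exception, and is trivial: both roundings
  are then constant).

Contrast with round-to-nearest, where double rounding is harmful in general and innocuous only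
under precision-gap conditions ([Figueroa1995]; [Roux2014, Thm 20 / Table II]: `p₂ ≥ 2p₁ + 1`
and `emin₂ ≤ emin₁` for a sum, Coq/Flocq; the cell's deterministic double-rounding tables): under
SR the criterion is purely set-theoretic, with no gap condition and no exception at saturation.
Prior art searched: the SR survey [CrociEtAl2022] and CHM21 [ConnollyHighamMary2021] treat one
SR step (and SR implemented from RN + TwoSum, or with few random bits,
doi:10.1109/ARITH64983.2025.00029); no statement on the composition of two stochastic roundings
was found — the results below are new.
-/

namespace Summit.Ventures.CertifiedArithmetic.LowPrec.SR

open Literature.ComputerArithmetic.ConnollyHighamMary2021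
open Finset

section Generic

variable {K : Type*} [Field K] [LinearOrder K] [IsStrictOrderedRing K]

/-! ### Clamping and stepping beyond the hull -/

omit [Field K] [IsStrictOrderedRing K] in
/-- Above the top everything clamps to `max F`. -/
theorem clamp_eq_max' {F : Finset K} (hF : F.Nonempty) {y : K} (h : F.max' hF ≤ y) :
    clamp F y = F.max' hF := by
  unfold clamp; rw [dif_pos hF, min_eq_right h, max_eq_right (F.min'_le_max' hF)]

omit [Field K] [IsStrictOrderedRing K] in
/-- Below the bottom everything clamps to `min F`. -/
theorem clamp_eq_min' {F : Finset K} (hF : F.Nonempty) {y : K} (h : y ≤ F.min' hF) :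
    clamp F y = F.min' hF := by
  unfold clamp; rw [dif_pos hF, max_eq_left (min_le_of_left_le h)]

omit [IsStrictOrderedRing K] in
/-- `E f(SR(y)) = f(max F)` for `y ≥ max F` (saturation). -/
theorem step_eq_of_max'_le {F : Finset K} (hF : F.Nonempty) {y : K} (h : F.max' hF ≤ y)
    (f : K → K) : step F y f = f (F.max' hF) := by
  have hm : F.max' hF ∈ F := F.max'_mem hF
  unfold step up dn
  rw [clamp_eq_max' hF h, roundUp_eq_self_of_mem hm, roundDown_eq_self_of_mem hm]; ring

omit [IsStrictOrderedRing K] in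
/-- `E f(SR(y)) = f(min F)` for `y ≤ min F` (saturation). -/
theorem step_eq_of_le_min' {F : Finset K} (hF : F.Nonempty) {y : K} (h : y ≤ F.min' hF)
    (f : K → K) : step F y f = f (F.min' hF) := by
  have hm : F.min' hF ∈ F := F.min'_mem hF
  unfold step up dn
  rw [clamp_eq_min' hF h, roundUp_eq_self_of_mem hm, roundDown_eq_self_of_mem hm]; ring

omit [Field K] [IsStrictOrderedRing K] in
/-- A member of `F` inside the candidate cell `[⌊c⌋, ⌈c⌉]` is one of the two candidates. -/
theorem eq_dn_or_up_of_mem_cell {F : Finset K} {c z : K} (hz : z ∈ F) (h1 : dn F c ≤ z)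
    (h2 : z ≤ up F c) : z = dn F c ∨ z = up F c := by
  rcases le_total z c with h | h
  · exact Or.inl (le_antisymm (le_dn_of_mem hz h) h1)
  · exact Or.inr (le_antisymm h2 (up_le_of_mem hz h))

/-! ### One SR step is affine across a cell -/

omit [IsStrictOrderedRing K] in
/-- SR preserves affine functions: `E[A + (SR(c) − d)·k] = A + (c − d)·k` inside the hull. -/
theorem step_affine_of_inHull {F : Finset K} {c : K} (hc : InHull F c) (A d k : K) :
    step F c (fun y => A + (y - d) * k) = A + (c - d) * k := by
  have e : (fun y : K => A + (y - d) * k) = fun y => (A - d * k) + k * y := by funext y; ring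
  rw [e, step_add F c (fun _ => A - d * k) (fun y => k * y), step_const, step_mul_left, step_id,
    clamp_eq_self hc]; ring

/-- **ONE SR STEP IS AFFINE ACROSS A CELL.** Let `c` lie in the hull of `F`, with candidates
`d = ⌊c⌋ ≤ u = ⌈c⌉`.  For every `y ∈ [d, u]` and every test function `f`:
`E f(SR_F(y)) = f(d) + (y − d)·(f(u) − f(d))/(u − d)` — the chord of `f` over the cell
(for `d = u`, i.e. `c ∈ F`, both sides are `f(c)`). [new] -/
theorem step_eq_affine {F : Finset K} {c y : K} (hc : InHull F c) (h1 : dn F c ≤ y)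
    (h2 : y ≤ up F c) (f : K → K) :
    step F y f = f (dn F c) + (y - dn F c) * ((f (up F c) - f (dn F c)) / (up F c - dn F c)) := by
  have hF : F.Nonempty := by obtain ⟨⟨z, hz, -⟩, -⟩ := hc; exact ⟨z, hz⟩
  have hdF : dn F c ∈ F := dn_mem hF c
  have huF : up F c ∈ F := up_mem hF c
  have hy : InHull F y := ⟨⟨_, hdF, h1⟩, ⟨_, huF, h2⟩⟩
  by_cases hud : up F c = dn F c
  · -- degenerate cell: `y = d = u ∈ F`
    have hyd : y = dn F c := le_antisymm (hud ▸ h2) h1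
    rw [hyd, step_of_mem hdF]; ring
  -- proper cell: the candidates of `y` are among `{d, u}` and the mean of `SR(y)` is `y`
  have hne : up F c - dn F c ≠ 0 := sub_ne_zero.mpr hud
  have hk : (up F c - dn F c) * ((f (up F c) - f (dn F c)) / (up F c - dn F c))
      = f (up F c) - f (dn F c) := by field_simp
  have hmean : pUp F y * up F y + (1 - pUp F y) * dn F y = y := by
    have h := step_id F y; unfold step at h; rwa [clamp_eq_self hy] at h
  have hcy : clamp F y = y := clamp_eq_self hy
  have hd1 : dn F c ≤ dn F y := le_dn_of_mem hdF h1
  have hd2 : dn F y ≤ up F c := (dn_le_clamp F y).trans (hcy.le.trans h2)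
  have hu1 : dn F c ≤ up F y := h1.trans (hcy.ge.trans (clamp_le_up F y))
  have hu2 : up F y ≤ up F c := up_le_of_mem huF h2
  unfold step
  rcases eq_dn_or_up_of_mem_cell (dn_mem hF y) hd1 hd2 with hd | hd <;>
    rcases eq_dn_or_up_of_mem_cell (up_mem hF y) hu1 hu2 with hu | hu <;>
    rw [hd, hu] at hmean ⊢
  · linear_combination ((f (up F c) - f (dn F c)) / (up F c - dn F c)) * hmean
  · linear_combination ((f (up F c) - f (dn F c)) / (up F c - dn F c)) * hmean
      - pUp F y * hk
  · linear_combination ((f (up F c) - f (dn F c)) / (up F c - dn F c)) * hmean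
      - (1 - pUp F y) * hk
  · linear_combination ((f (up F c) - f (dn F c)) / (up F c - dn F c)) * hmean - hk

/-! ### Double SR, innocuous direction -/

/-- **DOUBLE STOCHASTIC ROUNDING IS INNOCUOUS WHEN THE TARGET EMBEDS.** If `F ⊆ G` (target
inside intermediate) then for EVERY input `c` and EVERY test function `f`:
`E f(SR_F(SR_G(c))) = E f(SR_F(c))` — SR into `G` followed by SR into `F` has exactly the law of
one SR into `F`; saturation of either step included, no gap condition. [new] -/
theorem step_step_of_subset {F G : Finset K} (hF : F.Nonempty) (hFG : F ⊆ G) (c : K)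
    (f : K → K) : step G c (fun y => step F y f) = step F c f := by
  have hdF : dn F c ∈ F := dn_mem hF c
  have huF : up F c ∈ F := up_mem hF c
  by_cases hc : InHull F c
  · -- both `G`-candidates of `c` lie in the `F`-cell of `c`, where the inner step is a chord
    have hdc : dn F c ≤ c := (dn_le_clamp F c).trans (clamp_eq_self hc).le
    have hcu : c ≤ up F c := (clamp_eq_self hc).ge.trans (clamp_le_up F c)
    have hcG : InHull G c := ⟨⟨_, hFG hdF, hdc⟩, ⟨_, hFG huF, hcu⟩⟩
    have h1 : dn F c ≤ dn G c := le_dn_of_mem (hFG hdF) hdc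
    have h2 : dn G c ≤ up F c := (dn_le_clamp G c).trans ((clamp_eq_self hcG).le.trans hcu)
    have h3 : dn F c ≤ up G c := hdc.trans ((clamp_eq_self hcG).ge.trans (clamp_le_up G c))
    have h4 : up G c ≤ up F c := up_le_of_mem (hFG huF) hcu
    rw [step_congr G c (g := fun y => f (dn F c) + (y - dn F c) *
        ((f (up F c) - f (dn F c)) / (up F c - dn F c)))
      (step_eq_affine hc h3 h4 f) (step_eq_affine hc h1 h2 f),
      step_affine_of_inHull hcG, step_eq_affine hc hdc hcu f]
  · -- `c` outside the hull of `F`: both roundings saturate to the same end of `F`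
    by_cases hlow : ∃ z ∈ F, z ≤ c
    · have hall : ∀ z ∈ F, z < c := fun z hz => lt_of_not_ge fun h => hc ⟨hlow, z, hz, h⟩
      have hm : F.max' hF < c := hall _ (F.max'_mem hF)
      have hmG : F.max' hF ∈ G := hFG (F.max'_mem hF)
      have h1 : F.max' hF ≤ dn G c := le_dn_of_mem hmG hm.le
      have h2 : F.max' hF ≤ up G c := h1.trans (LimitedBits.dn_le_up G c)
      rw [step_congr G c (g := fun _ => f (F.max' hF)) (step_eq_of_max'_le hF h2 f)
        (step_eq_of_max'_le hF h1 f), step_const, step_eq_of_max'_le hF hm.le]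
    · push Not at hlow
      have hm : c < F.min' hF := hlow _ (F.min'_mem hF)
      have hmG : F.min' hF ∈ G := hFG (F.min'_mem hF)
      have h1 : up G c ≤ F.min' hF := up_le_of_mem hmG hm.le
      have h2 : dn G c ≤ F.min' hF := (LimitedBits.dn_le_up G c).trans h1
      rw [step_congr G c (g := fun _ => f (F.min' hF)) (step_eq_of_le_min' hF h1 f)
        (step_eq_of_le_min' hF h2 f), step_const, step_eq_of_le_min' hF hm.le]

/-- In particular the composite is a single SR step in MEAN and VARIANCE: `E[SR_F(SR_G(c))] =
clamp_F(c)` and `E[(SR_F(SR_G(c)) − b)²] = E[(SR_F(c) − b)²]` when `F ⊆ G`. -/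
theorem step_step_id_of_subset {F G : Finset K} (hF : F.Nonempty) (hFG : F ⊆ G) (c : K) :
    step G c (fun y => step F y fun t => t) = clamp F c := by
  rw [step_step_of_subset hF hFG, step_id]

/-! ### Double SR, converse: agreement on quadratic tests forces the embedding -/

/-- An SR step of a pointwise nonnegative function has expectation zero only if the function
vanishes at each candidate that carries positive probability. -/
theorem apply_eq_zero_of_step_eq_zero {F : Finset K} {c : K} {g : K → K} (hg : ∀ z, 0 ≤ g z)
    (h : step F c g = 0) :
    (0 < pUp F c → g (up F c) = 0) ∧ (pUp F c < 1 → g (dn F c) = 0) := by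
  unfold step at h
  have ha : 0 ≤ pUp F c * g (up F c) := mul_nonneg (pUp_nonneg F c) (hg _)
  have hb : 0 ≤ (1 - pUp F c) * g (dn F c) :=
    mul_nonneg (by linarith [pUp_le_one F c]) (hg _)
  have ha0 : pUp F c * g (up F c) = 0 := by linarith
  have hb0 : (1 - pUp F c) * g (dn F c) = 0 := by linarith
  refine ⟨fun hp => ?_, fun hp => ?_⟩
  · rcases mul_eq_zero.mp ha0 with h1 | h1
    · linarith
    · exact h1
  · rcases mul_eq_zero.mp hb0 with h1 | h1
    · linarith
    · exact h1

/-- The quadratic test: `E[(SR_F(y) − x)²] = 0` forces the mean `clamp_F(y)` to be `x`. -/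
theorem clamp_eq_of_step_sq_eq_zero {F : Finset K} {y x : K}
    (h : step F y (fun z => (z - x) ^ 2) = 0) : clamp F y = x := by
  have hmean : pUp F y * up F y + (1 - pUp F y) * dn F y = clamp F y := by
    have h' := step_id F y; unfold step at h'; exact h'
  obtain ⟨hu, hd⟩ := apply_eq_zero_of_step_eq_zero (fun z => sq_nonneg (z - x)) h
  have hp0 := pUp_nonneg F y
  have hp1 := pUp_le_one F y
  rw [← hmean]
  rcases hp0.lt_or_eq with hp | hp
  · have hux : up F y = x := by
      have h1 : (up F y - x) ^ 2 = 0 := hu hp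
      nlinarith [sq_nonneg (up F y - x)]
    rcases hp1.lt_or_eq with hq | hq
    · have hdx : dn F y = x := by
        have h1 : (dn F y - x) ^ 2 = 0 := hd hq
        nlinarith [sq_nonneg (dn F y - x)]
      rw [hux, hdx]; ring
    · rw [hq, hux]; ring
  · have hdx : dn F y = x := by
      have h1 : (dn F y - x) ^ 2 = 0 := hd (by rw [← hp]; exact zero_lt_one)
      nlinarith [sq_nonneg (dn F y - x)]
    rw [← hp, hdx]; ring

omit [Field K] [IsStrictOrderedRing K] in
/-- If `y ≠ x ∈ F` clamps to `x`, then `x` is an end of `F` and `y` lies beyond it. -/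
theorem end_of_clamp_eq {F : Finset K} (hF : F.Nonempty) {y x : K} (hyx : y ≠ x)
    (h : clamp F y = x) : (F.max' hF = x ∧ x < y) ∨ (F.min' hF = x ∧ y < x) := by
  have hy : ¬ InHull F y := fun hy => hyx ((clamp_eq_self hy).symm.trans h)
  by_cases hlow : ∃ z ∈ F, z ≤ y
  · have hall : ∀ z ∈ F, z < y := fun z hz => lt_of_not_ge fun h' => hy ⟨hlow, z, hz, h'⟩
    have hm : F.max' hF < y := hall _ (F.max'_mem hF)
    rw [clamp_eq_max' hF hm.le] at h
    exact Or.inl ⟨h, h ▸ hm⟩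
  · push Not at hlow
    have hm : y < F.min' hF := hlow _ (F.min'_mem hF)
    rw [clamp_eq_min' hF hm.le] at h
    exact Or.inr ⟨h, h ▸ hm⟩

omit [Field K] [IsStrictOrderedRing K] in
/-- Inside the hull of `G` but not in `G`: the lower candidate is strictly below. -/
theorem dn_lt_of_not_mem {G : Finset K} (hG : G.Nonempty) {x : K} (hx : InHull G x)
    (hxG : x ∉ G) : dn G x < x :=
  lt_of_le_of_ne ((dn_le_clamp G x).trans (clamp_eq_self hx).le)
    fun h => hxG (h ▸ dn_mem hG x)

omit [Field K] [IsStrictOrderedRing K] in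
/-- Inside the hull of `G` but not in `G`: the upper candidate is strictly above. -/
theorem lt_up_of_not_mem {G : Finset K} (hG : G.Nonempty) {x : K} (hx : InHull G x)
    (hxG : x ∉ G) : x < up G x :=
  lt_of_le_of_ne ((clamp_eq_self hx).ge.trans (clamp_le_up G x))
    fun h => hxG (h.symm ▸ up_mem hG x)

/-- Inside the hull of `G` but not in `G`: both candidates carry positive probability. -/
theorem pUp_pos_lt_one_of_not_mem {G : Finset K} (hG : G.Nonempty) {x : K} (hx : InHull G x)
    (hxG : x ∉ G) : 0 < pUp G x ∧ pUp G x < 1 := by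
  have h1 := dn_lt_of_not_mem hG hx hxG
  have h2 := lt_up_of_not_mem hG hx hxG
  unfold dn at h1; unfold up at h2
  rw [clamp_eq_self hx] at h1 h2
  unfold pUp probUp
  rw [clamp_eq_self hx]
  have h3 : 0 < roundUp G x - roundDown G x := by linarith
  exact ⟨div_pos (by linarith) h3, (div_lt_one h3).mpr (by linarith)⟩

/-- KEY STEP OF THE CONVERSE.  Let `F` have two distinct elements and let `x ∈ F ∖ G` be a point
where double SR agrees with single SR on the quadratic test `(· − x)²`.  Then `G` lies entirely
on one side of `x`, and `x` is the corresponding END of `F`. -/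
theorem side_of_not_mem {F G : Finset K} (hF : F.Nonempty) (hab : F.min' hF < F.max' hF)
    (hG : G.Nonempty) {x : K} (hx : x ∈ F) (hxG : x ∉ G)
    (h : step G x (fun y => step F y fun z => (z - x) ^ 2) = step F x fun z => (z - x) ^ 2) :
    ((∀ z ∈ G, x < z) ∧ F.max' hF = x) ∨ ((∀ z ∈ G, z < x) ∧ F.min' hF = x) := by
  rw [step_of_mem hx, sub_self, sq, mul_zero] at h
  have hg : ∀ y, 0 ≤ step F y fun z => (z - x) ^ 2 := fun y => by
    have h' := step_mono F y (f := fun _ => (0 : K)) (g := fun z => (z - x) ^ 2)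
      fun t => sq_nonneg _
    rwa [step_const] at h'
  obtain ⟨hup, hdn⟩ := apply_eq_zero_of_step_eq_zero hg h
  by_cases hxh : InHull G x
  · -- both candidates of `x` fire: `x` would be both ends of `F`
    exfalso
    obtain ⟨hp0, hp1⟩ := pUp_pos_lt_one_of_not_mem hG hxh hxG
    have hu := end_of_clamp_eq hF (lt_up_of_not_mem hG hxh hxG).ne'
      (clamp_eq_of_step_sq_eq_zero (hup hp0))
    have hd := end_of_clamp_eq hF (dn_lt_of_not_mem hG hxh hxG).ne
      (clamp_eq_of_step_sq_eq_zero (hdn hp1))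
    have hlt1 := lt_up_of_not_mem hG hxh hxG
    have hlt2 := dn_lt_of_not_mem hG hxh hxG
    rcases hu with ⟨hM, -⟩ | ⟨-, hlt⟩
    · rcases hd with ⟨-, hlt⟩ | ⟨hm, -⟩
      · linarith
      · rw [hM, hm] at hab; exact lt_irrefl _ hab
    · linarith
  · by_cases hlow : ∃ z ∈ G, z ≤ x
    · -- `G` below `x`: the only candidate is `max G < x`, which must clamp to `x` in `F`
      have hall : ∀ z ∈ G, z < x := fun z hz => lt_of_not_ge fun h' => hxh ⟨hlow, z, hz, h'⟩
      have hM : G.max' hG < x := hall _ (G.max'_mem hG)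
      have hdnG : dn G x = G.max' hG := by
        unfold dn; rw [clamp_eq_max' hG hM.le, roundDown_eq_self_of_mem (G.max'_mem hG)]
      have hp : pUp G x = 0 := by
        unfold pUp probUp
        rw [clamp_eq_max' hG hM.le, roundDown_eq_self_of_mem (G.max'_mem hG), sub_self, zero_div]
      have h2 := clamp_eq_of_step_sq_eq_zero (hdn (by rw [hp]; exact zero_lt_one))
      rw [hdnG] at h2
      rcases end_of_clamp_eq hF hM.ne h2 with ⟨-, hlt⟩ | ⟨hm, -⟩
      · linarith
      · exact Or.inr ⟨hall, hm⟩
    · -- `G` above `x`: symmetric, the only candidate is `min G > x`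
      push Not at hlow
      have hm : x < G.min' hG := hlow _ (G.min'_mem hG)
      have hdnG : dn G x = G.min' hG := by
        unfold dn; rw [clamp_eq_min' hG hm.le, roundDown_eq_self_of_mem (G.min'_mem hG)]
      have hp : pUp G x = 0 := by
        unfold pUp probUp
        rw [clamp_eq_min' hG hm.le, roundDown_eq_self_of_mem (G.min'_mem hG), sub_self, zero_div]
      have h2 := clamp_eq_of_step_sq_eq_zero (hdn (by rw [hp]; exact zero_lt_one))
      rw [hdnG] at h2
      rcases end_of_clamp_eq hF hm.ne' h2 with ⟨hM, -⟩ | ⟨-, hlt⟩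
      · exact Or.inl ⟨hlow, hM⟩
      · linarith

/-- **CONVERSE: AGREEMENT FORCES THE EMBEDDING.** If `F` has two distinct elements and double SR
(`G` then `F`) agrees with single SR into `F` on the quadratic tests `(· − x)²` at the points
`x ∈ F`, then `F ⊆ G`.  (A singleton `F` is the only exception: both roundings are then the
constant.) [new] -/
theorem subset_of_step_step {F G : Finset K} (hF : F.Nonempty) (hab : F.min' hF < F.max' hF)
    (hG : G.Nonempty)
    (h : ∀ x ∈ F, step G x (fun y => step F y fun z => (z - x) ^ 2) =
      step F x fun z => (z - x) ^ 2) : F ⊆ G := by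
  intro x hx
  by_contra hxG
  have hminF : F.min' hF ∈ F := F.min'_mem hF
  have hmaxF : F.max' hF ∈ F := F.max'_mem hF
  have hxmin : F.min' hF ≤ x := F.min'_le x hx
  have hxmax : x ≤ F.max' hF := F.le_max' x hx
  obtain ⟨z, hz⟩ := hG
  rcases side_of_not_mem hF hab ⟨z, hz⟩ hx hxG (h x hx) with ⟨habove, hxM⟩ | ⟨hbelow, hxm⟩
  · -- `G` above `x = max F`: then `min F ∉ G`, and the key step at `min F` is contradictory
    have haG : F.min' hF ∉ G := fun haG => by have := habove _ haG; linarith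
    rcases side_of_not_mem hF hab ⟨z, hz⟩ hminF haG (h _ hminF) with ⟨-, hM⟩ | ⟨hbelow', -⟩
    · exact absurd hM hab.ne'
    · have h1 := habove z hz; have h2 := hbelow' z hz; linarith
  · have hbG : F.max' hF ∉ G := fun hbG => by have := hbelow _ hbG; linarith
    rcases side_of_not_mem hF hab ⟨z, hz⟩ hmaxF hbG (h _ hmaxF) with ⟨habove', -⟩ | ⟨-, hm⟩
    · have h1 := hbelow z hz; have h2 := habove' z hz; linarith
    · exact absurd hm hab.ne

/-- **DOUBLE STOCHASTIC ROUNDING IS INNOCUOUS IFF THE TARGET EMBEDS IN THE INTERMEDIATE SET**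
(`F` with at least two elements): SR into `G` followed by SR into `F` has the law of one SR into
`F` for every input iff `F ⊆ G`. [new] -/
theorem step_step_iff_subset {F G : Finset K} (hF : F.Nonempty) (hab : F.min' hF < F.max' hF)
    (hG : G.Nonempty) :
    (∀ (c : K) (f : K → K), step G c (fun y => step F y f) = step F c f) ↔ F ⊆ G :=
  ⟨fun h => subset_of_step_step hF hab hG fun x _ => h x _,
    fun hFG c f => step_step_of_subset hF hFG c f⟩

end Generic

end Summit.Ventures.CertifiedArithmetic.LowPrec.SR
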